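import Summits.AtomisticToContinuum.Crystallization.Theorems.SpectralChargeLedgerSummedShellPricingChartShell

/-!
# Route `SpectralChargeLedger`, crux `SummedShellPricing` (stmt-AtomisticToContinuum-17044, K1),
# line `Sketch`: stub `stub_goodShell_of_matching_hcp` — two-way θ-matching ⇒ τ-good shell (hcp)

For a cell `(a,h)` in K1's box (`47/50 ≤ a ≤ 1`, `|h − a√(2/3)| ≤ a/100`), a `1/3`-separated host
`S ⊆ ℝ³`, a site `y ∈ S`, tolerances `0 ≤ θ ≤ τ`, `θ ≤ a/20`, and a linear isometry `A`: if the
closed `3a/2`-neighbourhood of `y` in `S` is two-way `θ`-matched with `y + A (hcpStacking a h)`,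
then the open punctured `13/10·a`-shell `T := {z ∈ S : z ≠ y, dist z y < 13/10·a}` is `τ`-matched
BIJECTIVELY, through the same `A`, to the hcp reference shell
`R := {p ∈ hcpStacking a h : p ≠ 0, ‖p‖ < 13/10·a}` — the left (hcp) disjunct of K1-goodness.

PROOF. Instantiate the abstract two-way matching lemma `exists_equiv_of_two_way_matching` of the
chart-shell file with `g p := y + A p` and tolerance `θ`:
* (H1) `p ∈ R` has `‖p‖ < 13/10·a < 34/25·a`, hence `74/100 ≤ ‖p‖ ≤ 101/100·a ≤ 3a/2`
  (`norm_mem_Icc_of_mem_hcpStacking`); its `θ`-match `z ∈ S` satisfies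
  `dist z y ≤ ‖p‖ + θ ≤ 1.01a + a/20 < 1.3a` and `z ≠ y` (`‖p‖ ≥ 0.74 > θ`).
* (H2) `z ∈ T` has `dist z y < 1.3a ≤ 3a/2`; its match `p` is non-zero (`θ ≤ 1/20 < 1/3 ≤ dist z y`)
  and `‖p‖ ≤ dist z y + θ < 1.35a < 34/25·a`, hence `‖p‖ ≤ 1.01a < 1.3a`.
* separation: `1/3 > 2θ` on `T`; `min a h ≥ 74/100 > 2θ` on `R` (`le_dist_of_mem_barlowStacking`,
  `A` an isometry).
Finally `dist (t − y) (A q) = dist t (y + A q) ≤ θ ≤ τ`.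
No definition, no named fact; all `[folklore]`.
-/

noncomputable section

namespace Summit.AtomisticToContinuum.Crystallization.Theorems.SummedShellPricingGoodShellOfMatchingHcp

open Literature.MathematicalPhysics.StatisticalMechanics
open Summit.AtomisticToContinuum.Crystallization.Theorems.SummedShellPricingChartShell
  (exists_equiv_of_two_way_matching norm_mem_Icc_of_mem_hcpStacking box_bounds)

-- adapted from Summits/AtomisticToContinuum/Crystallization/Theorems/SpectralChargeLedgerSummedShellPricingChartShell.lean
-- (`exists_shellEquiv_of_chart`: configurations `Fin N → ℝ³` and radius `4` replaced by a host set
-- `S` and the closed punctured `3a/2`-ball)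
/-- **Two-way matching ⇒ matched first shell (hcp, same isometry).** For `(a,h)` in K1's box, a
`1/3`-separated host `S`, `y ∈ S`, `θ ≤ τ`, `θ ≤ a/20` and a linear isometry `A` such that the closed
punctured `3a/2`-neighbourhood of `y` in `S` and the non-zero points of `y + A (hcpStacking a h)` of
norm `≤ 3a/2` are mutually `θ`-matched, there is a bijection `e` from the open punctured
`13/10·a`-shell of `y` to the hcp reference shell with `dist (t − y) (A (e t)) ≤ τ`. [folklore] -/
theorem exists_shellEquiv_of_matching_hcp {a h : ℝ} (hba : 47 / 50 ≤ a) (hba1 : a ≤ 1)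
    (hbh : |h - a * Real.sqrt (2 / 3)| ≤ a / 100) {θ τ : ℝ} (hθτ : θ ≤ τ) (hθa : θ ≤ a / 20)
    {S : Set (EuclideanSpace ℝ (Fin 3))}
    (hsep : ∀ u ∈ S, ∀ v ∈ S, u ≠ v → (1 / 3 : ℝ) ≤ dist u v) {y : EuclideanSpace ℝ (Fin 3)}
    (hy : y ∈ S) (A : EuclideanSpace ℝ (Fin 3) →ₗᵢ[ℝ] EuclideanSpace ℝ (Fin 3))
    (h1 : ∀ p ∈ hcpStacking a h, p ≠ 0 → ‖p‖ ≤ 3 / 2 * a → ∃ z ∈ S, dist z (y + A p) ≤ θ)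
    (h2 : ∀ z ∈ S, z ≠ y → dist z y ≤ 3 / 2 * a → ∃ p ∈ hcpStacking a h, dist z (y + A p) ≤ θ) :
    ∃ e : ↥{z : EuclideanSpace ℝ (Fin 3) | z ∈ S ∧ z ≠ y ∧ dist z (y) < 13 / 10 * a} ≃
        ↥{p : EuclideanSpace ℝ (Fin 3) | p ∈ hcpStacking a h ∧ p ≠ 0 ∧ ‖p‖ < 13 / 10 * a},
      ∀ t : ↥{z : EuclideanSpace ℝ (Fin 3) | z ∈ S ∧ z ≠ y ∧ dist z (y) < 13 / 10 * a},
        dist ((t : EuclideanSpace ℝ (Fin 3)) - y)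
          (A ((e t : ↥{p : EuclideanSpace ℝ (Fin 3) | p ∈ hcpStacking a h ∧ p ≠ 0 ∧ ‖p‖ < 13 / 10 * a}) :
            EuclideanSpace ℝ (Fin 3))) ≤ τ := by
  obtain ⟨ha0, hh0, hmin, -⟩ := box_bounds hba hbh
  have hg : ∀ p : EuclideanSpace ℝ (Fin 3), dist (y + A p) y = ‖p‖ := fun p => by
    rw [dist_self_add_left, A.norm_map]
  have key := exists_equiv_of_two_way_matching
    (T := {z : EuclideanSpace ℝ (Fin 3) | z ∈ S ∧ z ≠ y ∧ dist z y < 13 / 10 * a})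
    (R := {p : EuclideanSpace ℝ (Fin 3) | p ∈ hcpStacking a h ∧ p ≠ 0 ∧ ‖p‖ < 13 / 10 * a})
    (fun p => y + A p) (θ := θ) ?_ ?_ ?_ ?_
  · obtain ⟨e, he⟩ := key
    exact ⟨e, fun t => by rw [dist_sub_eq_dist_add_left, add_comm]; exact (he t).trans hθτ⟩
  · -- every reference shell point is matched to a shell point
    rintro p ⟨hp, hp0, hpn⟩
    show ∃ z ∈ {z : EuclideanSpace ℝ (Fin 3) | z ∈ S ∧ z ≠ y ∧ dist z y < 13 / 10 * a},
      dist z (y + A p) ≤ θ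
    have hpn' : ‖p‖ < 34 / 25 * a := by linarith
    obtain ⟨hplo, hphi⟩ := norm_mem_Icc_of_mem_hcpStacking hba hbh hp hp0 hpn'
    obtain ⟨z, hzS, hz⟩ := h1 p hp hp0 (by linarith)
    refine ⟨z, ⟨hzS, ?_, ?_⟩, hz⟩
    · intro hzy
      rw [hzy, dist_comm, hg] at hz
      linarith
    · have := dist_triangle z (y + A p) y
      rw [hg] at this
      linarith
  · -- every shell point is matched to a reference shell point
    rintro z ⟨hzS, hne, hlt⟩
    show ∃ p ∈ {p : EuclideanSpace ℝ (Fin 3) | p ∈ hcpStacking a h ∧ p ≠ 0 ∧ ‖p‖ < 13 / 10 * a},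
      dist z (y + A p) ≤ θ
    obtain ⟨p, hp, hpz⟩ := h2 z hzS hne (by linarith)
    have hp0 : p ≠ 0 := by
      rintro rfl
      have := hsep z hzS y hy hne
      rw [map_zero, add_zero] at hpz
      linarith
    have hpn' : ‖p‖ < 34 / 25 * a := by
      have := dist_triangle (y + A p) z y
      rw [hg, dist_comm] at this
      linarith
    obtain ⟨-, hphi⟩ := norm_mem_Icc_of_mem_hcpStacking hba hbh hp hp0 hpn'
    exact ⟨p, ⟨hp, hp0, by linarith⟩, hpz⟩
  · -- distinct shell points are `1/3 > 2θ` apart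
    rintro z ⟨hzS, -, -⟩ z' ⟨hz'S, -, -⟩ hne
    have := hsep z hzS z' hz'S hne
    linarith
  · -- images of distinct reference shell points are `min a h > 2θ` apart
    rintro p ⟨hp, -, -⟩ p' ⟨hp', -, -⟩ hne
    show 2 * θ < dist (y + A p) (y + A p')
    rw [dist_add_left, A.dist_map]
    have := le_dist_of_mem_barlowStacking a h alternatingHagg ha0.le hh0.le hp hp' hne
    linarith

/-- **Stub `stub_goodShell_of_matching_hcp` — two-way `θ`-matching on the closed `3a/2`-ball ⇒
`τ`-good shell (hcp reference, same isometry).** For `(a,h)` in K1's box, a `1/3`-separated host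
`S`, `y ∈ S`, `0 ≤ θ ≤ τ`, `θ ≤ a/20`, and a linear isometry `A` two-way `θ`-matching the closed
punctured `3a/2`-neighbourhood of `y` with `y + A (hcpStacking a h ∖ {0})`, the open punctured
`13/10·a`-shell of `y` is `τ`-matched bijectively through `A` to the hcp reference shell, i.e. K1's
goodness disjunction holds (left disjunct, `exists_shellEquiv_of_matching_hcp`). [folklore] -/
theorem stub_goodShell_of_matching_hcp :
    ∀ (a h : ℝ), 47 / 50 ≤ a → a ≤ 1 → |h - a * Real.sqrt (2 / 3)| ≤ a / 100 →
    ∀ (θ τ : ℝ), 0 ≤ θ → θ ≤ τ → θ ≤ a / 20 →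
    ∀ (S : Set (EuclideanSpace ℝ (Fin 3))), (∀ u ∈ S, ∀ v ∈ S, u ≠ v → (1 / 3 : ℝ) ≤ dist u v) →
    ∀ y ∈ S, ∀ (A : EuclideanSpace ℝ (Fin 3) →ₗᵢ[ℝ] EuclideanSpace ℝ (Fin 3)),
      (∀ p ∈ hcpStacking a h, p ≠ 0 → ‖p‖ ≤ 3 / 2 * a → ∃ z ∈ S, dist z (y + A p) ≤ θ) →
      (∀ z ∈ S, z ≠ y → dist z y ≤ 3 / 2 * a → ∃ p ∈ hcpStacking a h, dist z (y + A p) ≤ θ) →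
      (∃ A : EuclideanSpace ℝ (Fin 3) →ₗᵢ[ℝ] EuclideanSpace ℝ (Fin 3),
        (∃ e : ↥{z : EuclideanSpace ℝ (Fin 3) | z ∈ S ∧ z ≠ y ∧ dist z (y) < 13 / 10 * a} ≃
            ↥{p : EuclideanSpace ℝ (Fin 3) | p ∈ hcpStacking a h ∧ p ≠ 0 ∧ ‖p‖ < 13 / 10 * a},
          ∀ t : ↥{z : EuclideanSpace ℝ (Fin 3) | z ∈ S ∧ z ≠ y ∧ dist z (y) < 13 / 10 * a},
            dist ((t : EuclideanSpace ℝ (Fin 3)) - y)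
              (A ((e t : ↥{p : EuclideanSpace ℝ (Fin 3) | p ∈ hcpStacking a h ∧ p ≠ 0 ∧ ‖p‖ < 13 / 10 * a}) : EuclideanSpace ℝ (Fin 3))) ≤ τ) ∨
        (∃ e : ↥{z : EuclideanSpace ℝ (Fin 3) | z ∈ S ∧ z ≠ y ∧ dist z (y) < 13 / 10 * a} ≃
            ↥{p : EuclideanSpace ℝ (Fin 3) | p ∈ fccStacking a h ∧ p ≠ 0 ∧ ‖p‖ < 13 / 10 * a},
          ∀ t : ↥{z : EuclideanSpace ℝ (Fin 3) | z ∈ S ∧ z ≠ y ∧ dist z (y) < 13 / 10 * a},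
            dist ((t : EuclideanSpace ℝ (Fin 3)) - y)
              (A ((e t : ↥{p : EuclideanSpace ℝ (Fin 3) | p ∈ fccStacking a h ∧ p ≠ 0 ∧ ‖p‖ < 13 / 10 * a}) : EuclideanSpace ℝ (Fin 3))) ≤ τ)) := by
  intro a h hba hba1 hbh θ τ _ hθτ hθa S hsep y hy A h1 h2
  exact ⟨A, Or.inl (exists_shellEquiv_of_matching_hcp hba hba1 hbh hθτ hθa hsep hy A h1 h2)⟩

end Summit.AtomisticToContinuum.Crystallization.Theorems.SummedShellPricingGoodShellOfMatchingHcp
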